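import Mathlib

/-!
# Route `FilamentSkeletonRss` · crux `SkeletonJ1R` (stmt-NavierStokesRegularity-23610) · stub F2 `LiaDefectL` — Γ-BOOKKEEPING ARITHMETIC (B0):
# the seven terms of the self-strand bound are each `≤ const · (√Γ + |τ|)/√log Γ`

Lead `ns-fsr-lead-23610` (g2), line `streamline_kantorovich_R` (skeleton of record v5).  Helper file `--supports stmt-NavierStokesRegularity-23610`;
pure real arithmetic (imports `Mathlib` only), kept apart so that the assembling theorem (brick B1) stays within default heartbeats.

Dictionary (all reals): `G = √Γ`, `L = log Γ`, `sL = √L` (`sL² = L`, `1 ≤ sL`), `u = √Γ + |τ|` (`G ≤ u`), `cΓ ≥ |Γγ_j/4π|`, `b ≥ |β⁻¹|` with `cΓ·b = κ/L`,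
window `R = r₀G`, `Lw − R = 2ℓ`, `ℓ = Rb·G·sL`, envelope parameters `H = b h₀`, `κR = b kR u`, `κ0 = b(e₀+Q₀)u`, `ε₁ = b Q₀`,
`κL = b(kR u + 2Q₀ Rb G sL)`, and the inputs `(κR R)² ≤ (δ₀/sL)²`, `Λ ≤ L`, `u² ≤ cu²·Γ·L`, `log(Lw/R) ≤ 2Rb sL/r₀`, `θ + θ² ≤ 2`, `2ℓ ≤ Lw`.
Lemmas `selfTerm_T1` … `selfTerm_T7` bound `cΓ·(16RH)`, `cΓ·(16Rκ_R²)`, `cΓ·8(κ_R R)²κ_RΛ`, `cΓ·16κ₀ log(Lw/R)`, `cΓ·16(ε₁+κ_L²)(Lw−R)`,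
`cΓ·16π(θ+θ²)/Lw`, `cΓ(e²/R²)κ₀` by explicit constants times `u/sL`.
HONEST FRAMING: MODEL rung, ∃-side helper lemmas toward stub F2 of a HYPOTHETICAL filament-type blow-up skeleton; F2 and the crux 23610 stay OPEN;
nothing here bears on Navier–Stokes regularity, which is NOT proved. [folklore]
-/

-- `dupNamespace` off: the module name repeats `NavierStokesRegularity` by the tree's `Summits/<S>/<S>/Theorems` layout (same as every sibling file).
set_option linter.dupNamespace false

noncomputable section

namespace Summit.NavierStokesRegularity.NavierStokesRegularity.Theorems.SkeletonJ1RFrame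

/-- Elementary: for `1 ≤ s`, `0 ≤ G ≤ u`: `G/s² ≤ u/s`, `u/s² ≤ u/s`, `G/s ≤ u/s`. [folklore] -/
theorem ratio_bounds {G u s : ℝ} (hG : 0 ≤ G) (hGu : G ≤ u) (hs : 1 ≤ s) :
    G / s ^ 2 ≤ u / s ∧ u / s ^ 2 ≤ u / s ∧ G / s ≤ u / s := by
  have hs0 : 0 < s := by linarith
  have hu : 0 ≤ u := hG.trans hGu
  refine ⟨?_, ?_, div_le_div_of_nonneg_right hGu hs0.le⟩
  · calc G / s ^ 2 ≤ u / s ^ 2 := div_le_div_of_nonneg_right hGu (by positivity)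
      _ ≤ u / s := div_le_div_of_nonneg_left hu hs0 (by nlinarith)
  · exact div_le_div_of_nonneg_left hu hs0 (by nlinarith)

variable {cΓ b κ L sL G u Γ : ℝ}

/-- Term 1: `cΓ·(16 R H) ≤ 16κ r₀ h₀ · u/sL`. [folklore] -/
theorem selfTerm_T1 {R H r₀ h₀ : ℝ} (hcb : cΓ * b = κ / L) (hsLL : sL ^ 2 = L) (hsL1 : 1 ≤ sL) (hG : 0 ≤ G) (hGu : G ≤ u)
    (hκ : 0 ≤ κ) (hr₀ : 0 ≤ r₀) (hh₀ : 0 ≤ h₀) (hR : R = r₀ * G) (hH : H = b * h₀) :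
    cΓ * (16 * R * H) ≤ κ * (16 * r₀ * h₀) * (u / sL) := by
  have hL0 : 0 < L := by rw [← hsLL]; positivity
  have heq : cΓ * (16 * R * H) = κ * (16 * r₀ * h₀) * (G / sL ^ 2) := by
    rw [hR, hH, show cΓ * (16 * (r₀ * G) * (b * h₀)) = (cΓ * b) * (16 * r₀ * h₀) * G by ring, hcb, hsLL]
    field_simp
  rw [heq]
  exact mul_le_mul_of_nonneg_left (ratio_bounds hG hGu hsL1).1 (by positivity)

/-- Term 2: `cΓ·(16 R κ_R²) ≤ κ·128π r₀ kR² cu²/θp · u/sL`. [folklore] -/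
theorem selfTerm_T2 {R κR r₀ kR cu θp : ℝ} (hcb : cΓ * b = κ / L) (hb : b = 8 * Real.pi / (θp * Γ * L)) (hsLL : sL ^ 2 = L)
    (hsL1 : 1 ≤ sL) (hG : 0 ≤ G) (hGu : G ≤ u) (hΓ : 0 < Γ) (hθp : 0 < θp) (hκ : 0 ≤ κ) (hr₀ : 0 ≤ r₀)
    (hu2 : u ^ 2 ≤ cu ^ 2 * Γ * L) (hR : R = r₀ * G) (hκR : κR = b * kR * u) :
    cΓ * (16 * R * κR ^ 2) ≤ κ * (128 * Real.pi * r₀ * kR ^ 2 * cu ^ 2 / θp) * (u / sL) := by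
  have hL0 : 0 < L := by rw [← hsLL]; positivity
  have h1 : cΓ * (16 * R * κR ^ 2) = κ * (16 * r₀ * kR ^ 2) * (8 * Real.pi / θp) * (u ^ 2 / (Γ * L)) * (G / sL ^ 2) := by
    rw [hR, hκR, show cΓ * (16 * (r₀ * G) * (b * kR * u) ^ 2) = (cΓ * b) * (16 * r₀ * kR ^ 2) * b * u ^ 2 * G by ring, hcb, hb, hsLL]
    field_simp
  rw [h1]
  have h2 : u ^ 2 / (Γ * L) ≤ cu ^ 2 := by rw [div_le_iff₀ (by positivity)]; linarith
  have hA : 0 ≤ κ * (16 * r₀ * kR ^ 2) * (8 * Real.pi / θp) := by positivity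
  have hu0 : 0 ≤ u := hG.trans hGu
  calc κ * (16 * r₀ * kR ^ 2) * (8 * Real.pi / θp) * (u ^ 2 / (Γ * L)) * (G / sL ^ 2)
      ≤ κ * (16 * r₀ * kR ^ 2) * (8 * Real.pi / θp) * cu ^ 2 * (u / sL) :=
        mul_le_mul (mul_le_mul_of_nonneg_left h2 hA) (ratio_bounds hG hGu hsL1).1 (by positivity) (by positivity)
    _ = κ * (128 * Real.pi * r₀ * kR ^ 2 * cu ^ 2 / θp) * (u / sL) := by ring

/-- Term 3: `cΓ·8(κ_R R)²κ_R Λ ≤ κ·8 kR δ₀² · u/sL`. [folklore] -/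
theorem selfTerm_T3 {R κR kR δ₀ Λ : ℝ} (hcb : cΓ * b = κ / L) (hsLL : sL ^ 2 = L) (hsL1 : 1 ≤ sL) (hG : 0 ≤ G) (hGu : G ≤ u)
    (hκ : 0 ≤ κ) (hcΓ : 0 ≤ cΓ) (hkR : 0 ≤ kR) (hb0 : 0 ≤ b) (hκRR : (κR * R) ^ 2 ≤ (δ₀ / sL) ^ 2) (hΛ0 : 0 ≤ Λ) (hΛL : Λ ≤ L)
    (hκR : κR = b * kR * u) :
    cΓ * (8 * (κR * R) ^ 2 * κR * Λ) ≤ κ * (8 * kR * δ₀ ^ 2) * (u / sL) := by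
  have hL0 : 0 < L := by rw [← hsLL]; positivity
  have hsL0 : 0 < sL := by linarith
  have hu : 0 ≤ u := hG.trans hGu
  have hκR0 : 0 ≤ κR := by rw [hκR]; positivity
  calc cΓ * (8 * (κR * R) ^ 2 * κR * Λ) ≤ cΓ * (8 * (δ₀ / sL) ^ 2 * κR * L) := by gcongr
    _ = κ * (8 * kR * δ₀ ^ 2) * (u / sL ^ 2) := by
        rw [hκR, show cΓ * (8 * (δ₀ / sL) ^ 2 * (b * kR * u) * L) = (cΓ * b) * (8 * kR * δ₀ ^ 2) * u * L / sL ^ 2 by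
          field_simp, hcb]
        field_simp
    _ ≤ κ * (8 * kR * δ₀ ^ 2) * (u / sL) := mul_le_mul_of_nonneg_left (ratio_bounds hG hGu hsL1).2.1 (by positivity)

/-- Term 4: `cΓ·16κ₀ log(Lw/R) ≤ κ·32(e₀+Q₀)Rb/r₀ · u/sL`. [folklore] -/
theorem selfTerm_T4 {κ0 e₀ Q₀ Rb r₀ lg : ℝ} (hcb : cΓ * b = κ / L) (hsLL : sL ^ 2 = L) (hsL1 : 1 ≤ sL) (hG : 0 ≤ G) (hGu : G ≤ u)
    (hcΓ : 0 ≤ cΓ) (hb0 : 0 ≤ b) (heQ : 0 ≤ e₀ + Q₀) (hr₀ : 0 < r₀) (hlg : lg ≤ 2 * Rb * sL / r₀) (hκ0 : κ0 = b * (e₀ + Q₀) * u) :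
    cΓ * (16 * κ0 * lg) ≤ κ * (32 * (e₀ + Q₀) * Rb / r₀) * (u / sL) := by
  have hsL0 : 0 < sL := by linarith
  have hu : 0 ≤ u := hG.trans hGu
  have hκ00 : 0 ≤ κ0 := by rw [hκ0]; positivity
  calc cΓ * (16 * κ0 * lg) ≤ cΓ * (16 * κ0 * (2 * Rb * sL / r₀)) := by gcongr
    _ = κ * (32 * (e₀ + Q₀) * Rb / r₀) * (u / sL) := by
        rw [hκ0, show cΓ * (16 * (b * (e₀ + Q₀) * u) * (2 * Rb * sL / r₀)) = (cΓ * b) * (32 * (e₀ + Q₀) * Rb / r₀) * u * sL by ring,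
          hcb, ← hsLL]
        field_simp

/-- Term 5: `cΓ·16(ε₁ + κ_L²)(Lw − R) ≤ κ·32Rb(Q₀ + 16π(kR²cu² + 4Q₀²Rb²)/θp) · u/sL`. [folklore] -/
theorem selfTerm_T5 {ε₁ κL D Rb Q₀ kR cu θp : ℝ} (hcb : cΓ * b = κ / L) (hb : b = 8 * Real.pi / (θp * Γ * L)) (hsLL : sL ^ 2 = L)
    (hGG : G ^ 2 = Γ) (hsL1 : 1 ≤ sL) (hG : 0 ≤ G) (hGu : G ≤ u) (hΓ : 0 < Γ) (hθp : 0 < θp) (hκ : 0 ≤ κ) (hcΓ : 0 ≤ cΓ) (hRb : 0 ≤ Rb)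
    (hQ₀ : 0 ≤ Q₀) (hu2 : u ^ 2 ≤ cu ^ 2 * Γ * L) (hD : D = 2 * Rb * G * sL) (hε₁ : ε₁ = b * Q₀)
    (hκL : κL = b * (kR * u + 2 * Q₀ * Rb * G * sL)) :
    cΓ * (16 * (ε₁ + κL ^ 2) * D) ≤ κ * (32 * Rb * (Q₀ + 16 * Real.pi * (kR ^ 2 * cu ^ 2 + 4 * Q₀ ^ 2 * Rb ^ 2) / θp)) * (u / sL) := by
  have hL0 : 0 < L := by rw [← hsLL]; positivity
  have hsL0 : 0 < sL := by linarith
  have hb0 : 0 ≤ b := by rw [hb]; positivity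
  have hκL2 : κL ^ 2 ≤ 2 * b ^ 2 * (kR ^ 2 * cu ^ 2 + 4 * Q₀ ^ 2 * Rb ^ 2) * (Γ * L) := by
    rw [hκL, mul_pow]
    have h1 : (kR * u + 2 * Q₀ * Rb * G * sL) ^ 2 ≤ 2 * (kR * u) ^ 2 + 2 * (2 * Q₀ * Rb * G * sL) ^ 2 := by
      nlinarith [sq_nonneg (kR * u - 2 * Q₀ * Rb * G * sL)]
    have h2 : (kR * u) ^ 2 ≤ kR ^ 2 * cu ^ 2 * (Γ * L) := by
      rw [mul_pow]; nlinarith [hu2, sq_nonneg kR]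
    have h3 : (2 * Q₀ * Rb * G * sL) ^ 2 = 4 * Q₀ ^ 2 * Rb ^ 2 * (Γ * L) := by rw [← hGG, ← hsLL]; ring
    nlinarith [sq_nonneg b]
  have hD0 : 0 ≤ D := by rw [hD]; positivity
  calc cΓ * (16 * (ε₁ + κL ^ 2) * D) ≤ cΓ * (16 * (b * Q₀ + 2 * b ^ 2 * (kR ^ 2 * cu ^ 2 + 4 * Q₀ ^ 2 * Rb ^ 2) * (Γ * L)) * D) := by
        rw [hε₁]; gcongr
    _ = κ * (32 * Rb * Q₀) * (G / sL) + κ * (32 * Rb * (16 * Real.pi * (kR ^ 2 * cu ^ 2 + 4 * Q₀ ^ 2 * Rb ^ 2) / θp)) * (G / sL) := by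
        rw [hD, show cΓ * (16 * (b * Q₀ + 2 * b ^ 2 * (kR ^ 2 * cu ^ 2 + 4 * Q₀ ^ 2 * Rb ^ 2) * (Γ * L)) * (2 * Rb * G * sL)) =
          (cΓ * b) * (32 * Rb * Q₀) * G * sL + (cΓ * b) * b * (64 * Rb * (kR ^ 2 * cu ^ 2 + 4 * Q₀ ^ 2 * Rb ^ 2)) * (Γ * L) * G * sL by ring,
          hcb, hb, ← hsLL]
        field_simp
        ring
    _ ≤ κ * (32 * Rb * Q₀) * (u / sL) + κ * (32 * Rb * (16 * Real.pi * (kR ^ 2 * cu ^ 2 + 4 * Q₀ ^ 2 * Rb ^ 2) / θp)) * (u / sL) :=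
        add_le_add (mul_le_mul_of_nonneg_left (ratio_bounds hG hGu hsL1).2.2 (by positivity))
          (mul_le_mul_of_nonneg_left (ratio_bounds hG hGu hsL1).2.2 (by positivity))
    _ = κ * (32 * Rb * (Q₀ + 16 * Real.pi * (kR ^ 2 * cu ^ 2 + 4 * Q₀ ^ 2 * Rb ^ 2) / θp)) * (u / sL) := by ring

/-- Term 6: `cΓ·16π(θ+θ²)/Lw ≤ 4/(θp Rb) · u/sL` (`cΓ = Γ/(4πθp)`, `Lw ≥ 2ℓ`, `ℓ = Rb G sL`, `θ + θ² ≤ 2`). [folklore] -/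
theorem selfTerm_T6 {θ Lw ℓ Rb θp : ℝ} (hcΓ : cΓ = Γ / (4 * Real.pi * θp)) (hGG : G ^ 2 = Γ) (hsL1 : 1 ≤ sL) (hG : 0 < G) (hGu : G ≤ u)
    (hθp : 0 < θp) (hRb : 0 < Rb) (hθ2 : θ + θ ^ 2 ≤ 2) (hℓ : ℓ = Rb * G * sL) (hLw : 2 * ℓ ≤ Lw) :
    cΓ * (16 * Real.pi * (θ + θ ^ 2) / Lw) ≤ 4 / (θp * Rb) * (u / sL) := by
  have hsL0 : 0 < sL := by linarith
  have hℓ0 : 0 < ℓ := by rw [hℓ]; positivity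
  have hΓ : 0 < Γ := by rw [← hGG]; positivity
  calc cΓ * (16 * Real.pi * (θ + θ ^ 2) / Lw) ≤ cΓ * (16 * Real.pi * 2 / (2 * ℓ)) := by
        rw [hcΓ]
        refine mul_le_mul_of_nonneg_left ?_ (by positivity)
        exact div_le_div₀ (by positivity) (by gcongr) (by positivity) hLw
    _ = 4 / (θp * Rb) * (G / sL) := by rw [hℓ, hcΓ, ← hGG]; field_simp; ring
    _ ≤ 4 / (θp * Rb) * (u / sL) := mul_le_mul_of_nonneg_left (ratio_bounds hG.le hGu hsL1).2.2 (by positivity)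

/-- Term 7: `cΓ(e²/R²)κ₀ ≤ κ e²(e₀+Q₀)/r₀² · u/sL`. [folklore] -/
theorem selfTerm_T7 {R κ0 e e₀ Q₀ r₀ : ℝ} (hcb : cΓ * b = κ / L) (hsLL : sL ^ 2 = L) (hGG : G ^ 2 = Γ) (hsL1 : 1 ≤ sL) (hG : 0 < G)
    (hGu : G ≤ u) (hΓ1 : 1 ≤ Γ) (hκ : 0 ≤ κ) (heQ : 0 ≤ e₀ + Q₀) (hr₀ : 0 < r₀) (hR : R = r₀ * G) (hκ0 : κ0 = b * (e₀ + Q₀) * u) :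
    cΓ * (e ^ 2 / R ^ 2) * κ0 ≤ κ * (e ^ 2 * (e₀ + Q₀) / r₀ ^ 2) * (u / sL) := by
  have hL0 : 0 < L := by rw [← hsLL]; positivity
  have hsL0 : 0 < sL := by linarith
  have hu0 : 0 ≤ u := hG.le.trans hGu
  have hΓ : 0 < Γ := by linarith
  have h1 : cΓ * (e ^ 2 / R ^ 2) * κ0 = κ * (e ^ 2 * (e₀ + Q₀) / r₀ ^ 2) * (u / (Γ * L)) := by
    rw [hR, hκ0, show cΓ * (e ^ 2 / (r₀ * G) ^ 2) * (b * (e₀ + Q₀) * u) = (cΓ * b) * (e ^ 2 * (e₀ + Q₀)) * u / (r₀ * G) ^ 2 by ring,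
      hcb, mul_pow, hGG]
    field_simp
  rw [h1]
  refine mul_le_mul_of_nonneg_left ?_ (by positivity)
  calc u / (Γ * L) ≤ u / sL ^ 2 := by
        rw [hsLL]; exact div_le_div_of_nonneg_left hu0 hL0 (by nlinarith)
    _ ≤ u / sL := (ratio_bounds hG.le hGu hsL1).2.1

end Summit.NavierStokesRegularity.NavierStokesRegularity.Theorems.SkeletonJ1RFrame

end
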